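import Mathlib
import HarnessLib
import Literature.MathematicalPhysics.QuantumFieldTheory.ConstructiveQFTWave0
import Summits.Ventures.LatticeQCDFlow.Exactness.LatticeCoordAvg
import Summits.Ventures.LatticeQCDFlow.Scaling.AutoregressiveGaugeRedundancy

/-!
# LatticeQCDFlow / Scaling — gauge redundancy of the autoregressive context, V: the link closing a
# plaquette reads the other three only through the conjugacy class of the plaquette holonomy

HONEST FRAMING: exact (Metropolis-corrected) sampling algorithms for lattice gauge theory;
figures of merit are autocorrelation/cost numbers at stated couplings and volumes; no
continuum-physics claim.

Venture `LatticeQCDFlow` (cell pub-lqcd), topic `Scaling`, FANOUT row 30 (lean-1, GEN-15) — OUR WORK,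
fifth file on THEORY-2.md §4 row C5 for GAUGE links (I mechanism, II plaquette-mate witness, III
matchings, IV forests).  Files I–IV say what the exact autoregressive context of a gauge link is NOT
(buried links, matchings, forests: invisible).  This file is the first POSITIVE statement of what it
IS, in the smallest case: the four links `e₁ = (x,i)`, `e₂ = (x+e_i, j)`, `e₃ = (x+e_j, i)`,
`e₄ = (x, j)` of the plaquette `p = (x; i, j)` (`i ≠ j`, `L ≥ 2`), all OTHER links integrated
(`s ⊇` every other link at the four corners — e.g. `s = {e₁,…,e₄}ᶜ`: three plaquette links generated
first, the fourth next).  For every gauge-invariant weight `F`: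

* §1 two more reductions next to file I's `coordAvg_pathHolonomy` (in-out):
  `coordAvg_outOut` (two retained links STARTING at an otherwise integrated site are read through
  `U₁⁻¹ U₂`: `(U₁, U₂) ↦ (g U₁, g U₂)` changes nothing) and `coordAvg_conj_plaquette` (the gauge
  transformation equal to `g` at the four corners conjugates the four plaquette links at once).
* §2 (`s = {e₁,…,e₄}ᶜ`) **`coordAvg_plaquette_normalForm`**: `A_s F (U) = A_s F (1[e₁ ↦ c])` with
  `c = (U₄U₃)⁻¹ U₁ U₂` — three corner rotations (file I's `coordAvg_pathHolonomy` at `x + e_i` and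
  `x + e_j`, `coordAvg_outOut` at `x`) move all the information onto `e₁`, as a conjugate of the
  plaquette holonomy `U₁ U₂ U₃⁻¹ U₄⁻¹`; **`coordAvg_plaquette_classFunction`**: two configurations
  with CONJUGATE plaquette holonomies have the same marginal — `A_s F` is a class function of `hol_p`.
* §3 the autoregressive reading: `coordAvg_plaquettePath_const` (the marginal of the path
  `e₂, e₃, e₄` is constant: two burials and one rotation) and
  **`arConditional_plaquette_classFunction`**: generate `e₂, e₃, e₄` and then `e₁`; the exact
  conditional density of `U_{e₁}` given `(U_{e₂}, U_{e₃}, U_{e₄})`, `A_s F / A_{insert e₁ s} F`, depends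
  on the four links only through the conjugacy class of `U_{e₁} · U_{e₂} U_{e₃}⁻¹ U_{e₄}⁻¹` (link times
  STAPLE): ONE class-valued context instead of the three links of the symbolic context.

READING (value-free, for THEORY-2 §4 C5 repaired "modulo gauge"): the faithful unit of
autoregressive context for gauge links is a holonomy class, not a link: closing a plaquette costs one
class function's worth of conditioning; files I–IV are the degenerate cases (no closed loop through
the generated links ⇒ nothing is read).  NOT CLAIMED: larger / several loops ("the conditional reads
exactly the holonomy classes of the independent cycles closed so far" is expected, not typed); that
the class function is non-constant (cf. `WilsonPlaquetteMateContext`); any number of ours.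
Elementary over file I; no definition is introduced; nothing is cited as a fact; no `sorry`.
-/

noncomputable section

namespace Summit.Ventures.LatticeQCDFlow.Theory2.Autoregressive

open MeasureTheory Function
open Literature.MathematicalPhysics.QuantumFieldTheory
open Summit.Ventures.LatticeQCDFlow.Exactness

variable {d L N : ℕ} {G : Type*} [Group G]

variable [TopologicalSpace G] [IsTopologicalGroup G] [CompactSpace G] [MeasurableSpace G]
  [BorelSpace G]

/-! ## §1 Two more single-site reductions -/

/-- **Out-out reduction**: if the links at the site `y` outside `s` are exactly `ℓ₁ ≠ ℓ₂`, both
STARTING at `y` (neither a loop), then for gauge-invariant `F` the marginal `A_s F` reads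
`U_{ℓ₁}`, `U_{ℓ₂}` only through `U_{ℓ₁}⁻¹ U_{ℓ₂}`: `(U_{ℓ₁}, U_{ℓ₂}) ↦ (g U_{ℓ₁}, g U_{ℓ₂})` changes
nothing. [ours] -/
theorem coordAvg_outOut [NeZero L] {s : Finset (Edge d L)} {F : GaugeConfig d L G → ℝ}
    (hF : IsGaugeInvariant F) {y : Site d L} {ℓ₁ ℓ₂ : Edge d L} (hne : ℓ₁ ≠ ℓ₂)
    (h₁ : ℓ₁.1 = y) (h₁' : ℓ₁.1.shift ℓ₁.2 ≠ y) (h₂ : ℓ₂.1 = y) (h₂' : ℓ₂.1.shift ℓ₂.2 ≠ y)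
    (hstar : ∀ e : Edge d L, e.1 = y ∨ e.1.shift e.2 = y → e ≠ ℓ₁ → e ≠ ℓ₂ → e ∈ s)
    (U : GaugeConfig d L G) (g : G) :
    coordAvg (haarProbability G) s F (update (update U ℓ₁ (g * U ℓ₁)) ℓ₂ (g * U ℓ₂)) =
      coordAvg (haarProbability G) s F U := by
  refine coordAvg_eq_of_gaugeRelated_off s hF (Pi.mulSingle y g) fun e he => ?_
  by_cases he₂ : e = ℓ₂
  · subst he₂
    rw [update_self, gaugeTransform_mulSingle_apply_of_fst_eq g U h₂ h₂']
  rw [update_of_ne he₂]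
  by_cases he₁ : e = ℓ₁
  · subst he₁
    rw [update_self, gaugeTransform_mulSingle_apply_of_fst_eq g U h₁ h₁']
  rw [update_of_ne he₁]
  have hni : ¬ (e.1 = y ∨ e.1.shift e.2 = y) := fun hi => he (hstar e hi he₁ he₂)
  exact (gaugeTransform_mulSingle_apply_of_not_incident y g U (fun h1 => hni (Or.inl h1))
    (fun h2 => hni (Or.inr h2))).symm

/-- **Corner conjugation**: the gauge transformation equal to `g` at the four corners
`x, x+e_i, x+e_j, x+e_i+e_j` of the plaquette `(x; i, j)` and `1` elsewhere conjugates the four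
plaquette links (both endpoints are corners) and otherwise moves only links touching a corner; so if
`s` contains every link touching a corner except the four plaquette links, conjugating the four
plaquette links by `g` does not change `A_s F`. [ours] -/
theorem coordAvg_conj_plaquette [NeZero L] {s : Finset (Edge d L)} {F : GaugeConfig d L G → ℝ}
    (hF : IsGaugeInvariant F) (x : Site d L) (i j : Fin d)
    (hs : ∀ e : Edge d L, (e.1 = x ∨ e.1 = x.shift i ∨ e.1 = x.shift j ∨ e.1 = (x.shift i).shift j ∨
        e.1.shift e.2 = x ∨ e.1.shift e.2 = x.shift i ∨ e.1.shift e.2 = x.shift j ∨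
        e.1.shift e.2 = (x.shift i).shift j) →
      e ≠ (x, i) → e ≠ (x.shift i, j) → e ≠ (x.shift j, i) → e ≠ (x, j) → e ∈ s)
    (U : GaugeConfig d L G) (g : G) :
    coordAvg (haarProbability G) s F
        (update (update (update (update U (x, i) (g * U (x, i) * g⁻¹)) (x.shift i, j)
          (g * U (x.shift i, j) * g⁻¹)) (x.shift j, i) (g * U (x.shift j, i) * g⁻¹)) (x, j)
          (g * U (x, j) * g⁻¹)) =
      coordAvg (haarProbability G) s F U := by
  classical
  -- the corner transformation
  let C : Set (Site d L) := {x, x.shift i, x.shift j, (x.shift i).shift j}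
  let γ : Site d L → G := fun y => if y ∈ C then g else 1
  have hshift : (x.shift j).shift i = (x.shift i).shift j := by
    simp only [Site.shift]; abel
  have hγ : ∀ y, y ∈ C → γ y = g := fun y hy => by simp [γ, hy]
  have hx : x ∈ C := by simp [C]
  have hxi : x.shift i ∈ C := by simp [C]
  have hxj : x.shift j ∈ C := by simp [C]
  have hxij : (x.shift i).shift j ∈ C := by simp [C]
  refine coordAvg_eq_of_gaugeRelated_off s hF γ fun e he => ?_
  -- evaluate both sides at `e`
  by_cases h4 : e = (x, j)
  · subst h4
    rw [update_self]
    simp only [gaugeTransform, Site.shift] at *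
    rw [hγ _ hx, hγ _ hxj]
  rw [update_of_ne h4]
  by_cases h3 : e = (x.shift j, i)
  · subst h3
    rw [update_self]
    simp only [gaugeTransform]
    rw [hγ _ hxj, hshift, hγ _ hxij]
  rw [update_of_ne h3]
  by_cases h2 : e = (x.shift i, j)
  · subst h2
    rw [update_self]
    simp only [gaugeTransform]
    rw [hγ _ hxi, hγ _ hxij]
  rw [update_of_ne h2]
  by_cases h1 : e = (x, i)
  · subst h1
    rw [update_self]
    simp only [gaugeTransform]
    rw [hγ _ hx, hγ _ hxi]
  rw [update_of_ne h1]
  -- any other link off `s` touches no corner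
  have hnot : ¬ (e.1 = x ∨ e.1 = x.shift i ∨ e.1 = x.shift j ∨ e.1 = (x.shift i).shift j ∨
      e.1.shift e.2 = x ∨ e.1.shift e.2 = x.shift i ∨ e.1.shift e.2 = x.shift j ∨
      e.1.shift e.2 = (x.shift i).shift j) := fun h => he (hs e h h1 h2 h3 h4)
  have hγ1 : γ e.1 = 1 := by
    simp only [γ, C, Set.mem_insert_iff, Set.mem_singleton_iff]
    rw [if_neg]
    intro h
    exact hnot (by tauto)
  have hγ2 : γ (e.1.shift e.2) = 1 := by
    simp only [γ, C, Set.mem_insert_iff, Set.mem_singleton_iff]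
    rw [if_neg]
    intro h
    exact hnot (by tauto)
  simp [gaugeTransform, hγ1, hγ2]

/-! ## §2 Normal form and class-function property -/

/-- The four plaquette links are pairwise distinct (`i ≠ j`, `L ≥ 2`). [ours] -/
theorem plaquetteLinks_distinct (hL : 2 ≤ L) (x : Site d L) {i j : Fin d} (hij : i ≠ j) :
    ((x, i) : Edge d L) ≠ (x.shift i, j) ∧ ((x, i) : Edge d L) ≠ (x.shift j, i) ∧
      ((x, i) : Edge d L) ≠ (x, j) ∧ ((x.shift i, j) : Edge d L) ≠ (x.shift j, i) ∧
      ((x.shift i, j) : Edge d L) ≠ (x, j) ∧ ((x.shift j, i) : Edge d L) ≠ (x, j) := by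
  haveI : Fact (1 < L) := ⟨hL⟩
  have hji : j ≠ i := fun h => hij h.symm
  have hsx : ∀ k : Fin d, x.shift k ≠ x := by
    intro k h
    have h1 : (x.shift k) k = x k := by rw [h]
    simp [Site.shift] at h1
  refine ⟨fun h => hij (congrArg Prod.snd h), fun h => hsx j (congrArg Prod.fst h).symm,
    fun h => hij (congrArg Prod.snd h), fun h => hji (congrArg Prod.snd h),
    fun h => hsx i (congrArg Prod.fst h), fun h => hij (congrArg Prod.snd h)⟩

/-- The four corners `x`, `x + e_i`, `x + e_j`, `x + e_i + e_j` of a plaquette are pairwise distinct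
and `x + e_j + e_i = x + e_i + e_j` (`i ≠ j`, `L ≥ 2`). [ours] -/
theorem plaquetteCorners_distinct (hL : 2 ≤ L) (x : Site d L) {i j : Fin d} (hij : i ≠ j) :
    x ≠ x.shift i ∧ x ≠ x.shift j ∧ x ≠ (x.shift i).shift j ∧ x.shift i ≠ x.shift j ∧
      x.shift i ≠ (x.shift i).shift j ∧ x.shift j ≠ (x.shift i).shift j ∧
      (x.shift j).shift i = (x.shift i).shift j := by
  haveI : Fact (1 < L) := ⟨hL⟩
  have hji : j ≠ i := fun h => hij h.symm
  have hcomm : (x.shift j).shift i = (x.shift i).shift j := by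
    simp only [Site.shift]; abel
  refine ⟨fun h => ?_, fun h => ?_, fun h => ?_, fun h => ?_, fun h => ?_, fun h => ?_, hcomm⟩
  · have h1 := congrFun h i; simp [Site.shift] at h1
  · have h1 := congrFun h j; simp [Site.shift] at h1
  · have h1 := congrFun h i; simp [Site.shift, hji] at h1
  · have h1 := congrFun h i; simp [Site.shift, hji] at h1
  · have h1 := congrFun h j; simp [Site.shift] at h1
  · rw [← hcomm] at h
    have h1 := congrFun h i; simp [Site.shift] at h1

/-- **Normal form**: with `s = {e₁, e₂, e₃, e₄}ᶜ` (everything but the plaquette integrated), the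
marginal of a gauge-invariant `F` at `U` equals its value at the configuration `1[e₁ ↦ c]`,
`c = (U₄ U₃)⁻¹ (U₁ U₂)` — a conjugate of the plaquette holonomy `U₁ U₂ U₃⁻¹ U₄⁻¹` (rotate at
`x + e_i` to kill `e₂`, at `x + e_j` to kill `e₃`, at `x` to kill `e₄`). [ours] -/
theorem coordAvg_plaquette_normalForm [NeZero L] (hL : 2 ≤ L) {F : GaugeConfig d L G → ℝ}
    (hF : IsGaugeInvariant F) (x : Site d L) {i j : Fin d} (hij : i ≠ j) (U : GaugeConfig d L G) :
    coordAvg (haarProbability G)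
        (Finset.univ \ {(x, i), (x.shift i, j), (x.shift j, i), (x, j)}) F U =
      coordAvg (haarProbability G)
        (Finset.univ \ {(x, i), (x.shift i, j), (x.shift j, i), (x, j)}) F
        (update 1 (x, i) ((U (x, j) * U (x.shift j, i))⁻¹ * (U (x, i) * U (x.shift i, j)))) := by
  obtain ⟨n12, n13, n14, n23, n24, n34⟩ := plaquetteLinks_distinct hL x hij
  obtain ⟨c01, c02, c03, c12, c13, c23, hcomm⟩ := plaquetteCorners_distinct hL x hij
  set s : Finset (Edge d L) := Finset.univ \ {(x, i), (x.shift i, j), (x.shift j, i), (x, j)} with hs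
  have hmem : ∀ e : Edge d L, e ≠ (x, i) → e ≠ (x.shift i, j) → e ≠ (x.shift j, i) → e ≠ (x, j) →
      e ∈ s := by
    intro e h1 h2 h3 h4; simp [hs, h1, h2, h3, h4]
  -- Step A: rotate at `x + e_i` (e₁ in, e₂ out) by `(U e₂)⁻¹`
  have hstarA : ∀ e : Edge d L, e.1 = x.shift i ∨ e.1.shift e.2 = x.shift i → e ≠ (x, i) →
      e ≠ (x.shift i, j) → e ∈ s := by
    intro e he h1 h2
    refine hmem e h1 h2 (fun h => ?_) (fun h => ?_) <;> subst h <;> rcases he with h' | h'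
    · exact c12 h'.symm
    · exact c13 (h'.symm.trans hcomm)
    · exact c01 h'
    · exact c12 h'.symm
  have hA := coordAvg_pathHolonomy (s := s) hF (y := x.shift i) (ℓ₁ := (x, i))
    (ℓ₂ := (x.shift i, j)) n12 rfl c01 rfl (Ne.symm c13) hstarA U (U (x.shift i, j))⁻¹
  set UA : GaugeConfig d L G := update (update U (x, i) (U (x, i) * ((U (x.shift i, j))⁻¹)⁻¹))
    (x.shift i, j) ((U (x.shift i, j))⁻¹ * U (x.shift i, j)) with hUA
  -- Step B: rotate at `x + e_j` (e₄ in, e₃ out) by `(UA e₃)⁻¹`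
  have hstarB : ∀ e : Edge d L, e.1 = x.shift j ∨ e.1.shift e.2 = x.shift j → e ≠ (x, j) →
      e ≠ (x.shift j, i) → e ∈ s := by
    intro e he h4 h3
    refine hmem e (fun h => ?_) (fun h => ?_) h3 h4 <;> subst h <;> rcases he with h' | h'
    · exact c02 h'
    · exact c12 h'
    · exact c12 h'
    · exact c23 h'.symm
  have hB := coordAvg_pathHolonomy (s := s) hF (y := x.shift j) (ℓ₁ := (x, j))
    (ℓ₂ := (x.shift j, i)) (Ne.symm n34) rfl c02 rfl (by rw [hcomm]; exact Ne.symm c23) hstarB UA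
    (UA (x.shift j, i))⁻¹
  set UB : GaugeConfig d L G := update (update UA (x, j) (UA (x, j) * ((UA (x.shift j, i))⁻¹)⁻¹))
    (x.shift j, i) ((UA (x.shift j, i))⁻¹ * UA (x.shift j, i)) with hUB
  -- Step C: rotate at `x` (e₄ out, e₁ out) by `(UB e₄)⁻¹`
  have hstarC : ∀ e : Edge d L, e.1 = x ∨ e.1.shift e.2 = x → e ≠ (x, j) → e ≠ (x, i) → e ∈ s := by
    intro e he h4 h1
    refine hmem e h1 (fun h => ?_) (fun h => ?_) h4 <;> subst h <;> rcases he with h' | h'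
    · exact c01 h'.symm
    · exact c03 h'.symm
    · exact c02 h'.symm
    · exact c03 (h'.symm.trans hcomm)
  have hC := coordAvg_outOut (s := s) hF (y := x) (ℓ₁ := (x, j)) (ℓ₂ := (x, i)) (Ne.symm n14) rfl
    (Ne.symm c02) rfl (Ne.symm c01) hstarC UB (UB (x, j))⁻¹
  -- chain and compare with the normal form off `s`
  rw [← hA, ← hB, ← hC]
  refine coordAvg_congr_off s F fun e he => ?_
  have he' : e = (x, i) ∨ e = (x.shift i, j) ∨ e = (x.shift j, i) ∨ e = (x, j) := by
    by_contra hcon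
    push Not at hcon
    exact he (hmem e hcon.1 hcon.2.1 hcon.2.2.1 hcon.2.2.2)
  rcases he' with rfl | rfl | rfl | rfl <;>
    simp [hUB, hUA, n12, n13, n14, n23, n24, n34, Ne.symm n12, Ne.symm n13,
      Ne.symm n14, Ne.symm n23, Ne.symm n24, Ne.symm n34, mul_assoc]

/-- **The marginal of a plaquette is a CLASS FUNCTION of its holonomy**: with everything but the
four links of the plaquette `(x; i, j)` integrated, two configurations whose plaquette holonomies
`U₁ U₂ U₃⁻¹ U₄⁻¹` are conjugate have the same marginal, for every gauge-invariant `F`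
(normal form + corner conjugation). [ours] -/
theorem coordAvg_plaquette_classFunction [NeZero L] (hL : 2 ≤ L) {F : GaugeConfig d L G → ℝ}
    (hF : IsGaugeInvariant F) (x : Site d L) {i j : Fin d} (hij : i ≠ j) {U U' : GaugeConfig d L G}
    (k : G) (hconj : plaquetteHolonomy U' x i j = k * plaquetteHolonomy U x i j * k⁻¹) :
    coordAvg (haarProbability G)
        (Finset.univ \ {(x, i), (x.shift i, j), (x.shift j, i), (x, j)}) F U' =
      coordAvg (haarProbability G)
        (Finset.univ \ {(x, i), (x.shift i, j), (x.shift j, i), (x, j)}) F U := by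
  obtain ⟨n12, n13, n14, n23, n24, n34⟩ := plaquetteLinks_distinct hL x hij
  set s : Finset (Edge d L) := Finset.univ \ {(x, i), (x.shift i, j), (x.shift j, i), (x, j)} with hs
  have hmem : ∀ e : Edge d L, e ≠ (x, i) → e ≠ (x.shift i, j) → e ≠ (x.shift j, i) → e ≠ (x, j) →
      e ∈ s := by
    intro e h1 h2 h3 h4; simp [hs, h1, h2, h3, h4]
  rw [coordAvg_plaquette_normalForm hL hF x hij U', coordAvg_plaquette_normalForm hL hF x hij U]
  -- the two normal-form values are conjugate
  set c : G := (U (x, j) * U (x.shift j, i))⁻¹ * (U (x, i) * U (x.shift i, j)) with hc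
  set c' : G := (U' (x, j) * U' (x.shift j, i))⁻¹ * (U' (x, i) * U' (x.shift i, j)) with hc'
  set g : G := (U' (x, j) * U' (x.shift j, i))⁻¹ * k * (U (x, j) * U (x.shift j, i)) with hg
  have hcc : c' = g * c * g⁻¹ := by
    have h1 : c = (U (x, j) * U (x.shift j, i))⁻¹ * plaquetteHolonomy U x i j *
        (U (x, j) * U (x.shift j, i)) := by
      simp only [hc, plaquetteHolonomy]; group
    have h2 : c' = (U' (x, j) * U' (x.shift j, i))⁻¹ * plaquetteHolonomy U' x i j *
        (U' (x, j) * U' (x.shift j, i)) := by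
      simp only [hc', plaquetteHolonomy]; group
    rw [h2, hconj, h1, hg]; group
  -- conjugate the normal form of `U` by `g` at the four corners
  have hconjA := coordAvg_conj_plaquette (s := s) hF x i j
    (fun e _ h1 h2 h3 h4 => hmem e h1 h2 h3 h4) (update 1 (x, i) c) g
  rw [← hconjA, hcc]
  refine coordAvg_congr_off s F fun e he => ?_
  have he' : e = (x, i) ∨ e = (x.shift i, j) ∨ e = (x.shift j, i) ∨ e = (x, j) := by
    by_contra hcon
    push Not at hcon
    exact he (hmem e hcon.1 hcon.2.1 hcon.2.2.1 hcon.2.2.2)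
  rcases he' with rfl | rfl | rfl | rfl <;>
    simp [n12, n13, n14, n23, n24, n34, Ne.symm n12, Ne.symm n13, Ne.symm n14, mul_assoc]

/-! ## §3 The autoregressive reading: closing a plaquette reads one holonomy class -/

/-- The marginal of the three links `e₂, e₃, e₄` of the plaquette (a path: `e₂, e₄` have private
endpoints, `e₃` is reached by one more rotation at `x + e_j`) is CONSTANT, for every gauge-invariant
`F` (everything else integrated). [ours] -/
theorem coordAvg_plaquettePath_const [NeZero L] (hL : 2 ≤ L) {F : GaugeConfig d L G → ℝ}
    (hF : IsGaugeInvariant F) (x : Site d L) {i j : Fin d} (hij : i ≠ j) (U U' : GaugeConfig d L G) :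
    coordAvg (haarProbability G) (Finset.univ \ {(x.shift i, j), (x.shift j, i), (x, j)}) F U' =
      coordAvg (haarProbability G) (Finset.univ \ {(x.shift i, j), (x.shift j, i), (x, j)}) F U := by
  obtain ⟨n12, n13, n14, n23, n24, n34⟩ := plaquetteLinks_distinct hL x hij
  obtain ⟨c01, c02, c03, c12, c13, c23, hcomm⟩ := plaquetteCorners_distinct hL x hij
  set t : Finset (Edge d L) := Finset.univ \ {(x.shift i, j), (x.shift j, i), (x, j)} with ht
  have hmem : ∀ e : Edge d L, e ≠ (x.shift i, j) → e ≠ (x.shift j, i) → e ≠ (x, j) → e ∈ t := by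
    intro e h2 h3 h4; simp [ht, h2, h3, h4]
  -- `e₂` is buried at `x + e_i`, `e₄` at `x`
  have hstar2 : ∀ e : Edge d L, e.1 = x.shift i ∨ e.1.shift e.2 = x.shift i → e ≠ (x.shift i, j) →
      e ∈ t := by
    intro e he h2
    refine hmem e h2 (fun h => ?_) (fun h => ?_) <;> subst h <;> rcases he with h' | h'
    · exact c12 h'.symm
    · exact c13 (h'.symm.trans hcomm)
    · exact c01 h'
    · exact c12 h'.symm
  have hstar4 : ∀ e : Edge d L, e.1 = x ∨ e.1.shift e.2 = x → e ≠ (x, j) → e ∈ t := by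
    intro e he h4
    refine hmem e (fun h => ?_) (fun h => ?_) h4 <;> subst h <;> rcases he with h' | h'
    · exact c01 h'.symm
    · exact c03 h'.symm
    · exact c02 h'.symm
    · exact c03 (h'.symm.trans hcomm)
  have hb2 : ∀ (V : GaugeConfig d L G) (h : G),
      coordAvg (haarProbability G) t F (update V (x.shift i, j) h) = coordAvg (haarProbability G) t F V :=
    fun V h => coordAvg_update_of_buried hF (x := x.shift i) (ℓ := (x.shift i, j)) (Or.inl rfl)
      c13 hstar2 V h
  have hb4 : ∀ (V : GaugeConfig d L G) (h : G),
      coordAvg (haarProbability G) t F (update V (x, j) h) = coordAvg (haarProbability G) t F V :=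
    fun V h => coordAvg_update_of_buried hF (x := x) (ℓ := (x, j)) (Or.inl rfl) c02 hstar4 V h
  -- `e₃`: rotate at `x + e_j` (`e₄` in, `e₃` out); `e₄`'s change is invisible by `hb4`
  have hstar3 : ∀ e : Edge d L, e.1 = x.shift j ∨ e.1.shift e.2 = x.shift j → e ≠ (x, j) →
      e ≠ (x.shift j, i) → e ∈ t := by
    intro e he h4 h3
    refine hmem e (fun h => ?_) h3 h4; subst h; rcases he with h' | h'
    · exact c12 h'
    · exact c23 h'.symm
  have hb3 : ∀ (V : GaugeConfig d L G) (g : G),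
      coordAvg (haarProbability G) t F (update V (x.shift j, i) (g * V (x.shift j, i))) =
        coordAvg (haarProbability G) t F V := by
    intro V g
    have h := coordAvg_pathHolonomy (s := t) hF (y := x.shift j) (ℓ₁ := (x, j))
      (ℓ₂ := (x.shift j, i)) (Ne.symm n34) rfl c02 rfl (by rw [hcomm]; exact Ne.symm c23) hstar3 V g
    rw [← h, update_comm (Ne.symm n34), hb4]
  -- move `U'` to `U` link by link: e₂, e₄ (burial), e₃ (rotation), everything else is integrated
  calc coordAvg (haarProbability G) t F U'
      = coordAvg (haarProbability G) t F (update (update (update U' (x.shift i, j) (U (x.shift i, j)))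
          (x, j) (U (x, j))) (x.shift j, i) (U (x.shift j, i))) := by
        rw [show U (x.shift j, i) = (U (x.shift j, i) * (U' (x.shift j, i))⁻¹) *
            (update (update U' (x.shift i, j) (U (x.shift i, j))) (x, j) (U (x, j))) (x.shift j, i) by
          rw [update_of_ne n34, update_of_ne (Ne.symm n23)]; group]
        rw [hb3, hb4, hb2]
    _ = coordAvg (haarProbability G) t F U := by
        refine coordAvg_congr_off t F fun e he => ?_
        have he' : e = (x.shift i, j) ∨ e = (x.shift j, i) ∨ e = (x, j) := by
          by_contra hcon
          push Not at hcon
          exact he (hmem e hcon.1 hcon.2.1 hcon.2.2)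
        rcases he' with rfl | rfl | rfl <;>
          simp [n23, n24, Ne.symm n34]

/-- `insert e₁ ({e₁, e₂, e₃, e₄}ᶜ) = {e₂, e₃, e₄}ᶜ` for the plaquette links. [ours] -/
theorem insert_sdiff_plaquette [NeZero L] (hL : 2 ≤ L) (x : Site d L) {i j : Fin d} (hij : i ≠ j) :
    insert ((x, i) : Edge d L) (Finset.univ \ {(x, i), (x.shift i, j), (x.shift j, i), (x, j)}) =
      Finset.univ \ {(x.shift i, j), (x.shift j, i), (x, j)} := by
  obtain ⟨n12, n13, n14, -, -, -⟩ := plaquetteLinks_distinct hL x hij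
  ext e
  by_cases h : e = (x, i)
  · subst h; simp [n12, n13, n14]
  · simp [h]

/-- **CLOSING A PLAQUETTE READS ONE HOLONOMY CLASS.**  Generate the three links `e₂ = (x+e_i, j)`,
`e₃ = (x+e_j, i)`, `e₄ = (x, j)` first and then `e₁ = (x, i)` (`i ≠ j`, `L ≥ 2`); for every
gauge-invariant weight `F` the exact conditional density of `U_{e₁}` given `(U_{e₂}, U_{e₃}, U_{e₄})`,
`A_s F / A_{insert e₁ s} F` with `s = {e₁, e₂, e₃, e₄}ᶜ`, takes the same value on any two
configurations with CONJUGATE plaquette holonomies `U_{e₁} U_{e₂} U_{e₃}⁻¹ U_{e₄}⁻¹`: it is a class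
function of (link × staple) — one class-valued context replaces the three links of the symbolic
context (numerator: `coordAvg_plaquette_classFunction`; denominator: the path marginal is constant,
`coordAvg_plaquettePath_const`). [ours] -/
theorem arConditional_plaquette_classFunction [NeZero L] (hL : 2 ≤ L) {F : GaugeConfig d L G → ℝ}
    (hF : IsGaugeInvariant F) (x : Site d L) {i j : Fin d} (hij : i ≠ j) {U U' : GaugeConfig d L G}
    (k : G) (hconj : plaquetteHolonomy U' x i j = k * plaquetteHolonomy U x i j * k⁻¹) :
    let s : Finset (Edge d L) := Finset.univ \ {(x, i), (x.shift i, j), (x.shift j, i), (x, j)}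
    coordAvg (haarProbability G) s F U' / coordAvg (haarProbability G) (insert (x, i) s) F U' =
      coordAvg (haarProbability G) s F U / coordAvg (haarProbability G) (insert (x, i) s) F U := by
  intro s
  rw [coordAvg_plaquette_classFunction hL hF x hij k hconj, insert_sdiff_plaquette hL x hij,
    coordAvg_plaquettePath_const hL hF x hij U U']

end Summit.Ventures.LatticeQCDFlow.Theory2.Autoregressive

end
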